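import Summits.QuantumFields.YangMills.Theorems.LangevinControlUVFemtoCurvatureTwoPointCTriangularIntegration
import Summits.QuantumFields.YangMills.Theorems.LangevinControlUVFemtoCurvatureTwoPointCTorusTopLink
import Summits.QuantumFields.YangMills.Theorems.LangevinControlUVFemtoCurvatureTwoPointCOneLinkLaplace
import Summits.QuantumFields.YangMills.Theorems.LangevinControlUVFemtoCurvatureTwoPointStubDoublingOfRV
import Summits.QuantumFields.YangMills.Theorems.LangevinControlUVFemtoCurvatureTwoPointStubVarianceOfChessboardDoubling
import HarnessLib

/-!
# Route `LangevinControlUV`, crux `FemtoCurvatureTwoPointC` (stmt-QuantumFields-16204), line `birth` —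
# the triangular UPPER bound of the torus partition function

Registered wave-4 sub-goal `torusPartitionFunction_upper` (`--supports stmt-QuantumFields-16204`),
proved verbatim: for a compact second-countable group `G` with a faithful continuous unitary lattice
representation `r` (`D = dimE r.ρ`) there is `C > 0` with

  `Z_L(β) ≤ (C β^{−D/2}) ^ (3L⁴ − L³ − L² − L)`   for all tori `(ℤ/L)⁴`, `L ≥ 2`, and all `β ≥ 1`.

This is the upper half of the torus free-energy sandwich (the lower half is the gauge-fixed Gaussian
lower bound); together they give the `L`-uniform doubling `Z_L(β/2) ≤ e^{A L⁴} Z_L(β)` and hence the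
crux's variance-ceiling stub V.

**Proof.** Write `Z_L(β) = ∫ ∏ₚ wₚ dHaar^{⊗E}` with the plaquette weights
`wₚ(U) = e^{−β (N − Re tr r(U_p))} ∈ (0, 1]` (`partitionFunction_eq_lintegral_prod`; `Re tr r ≤ N`).
(1) Drop the plaquettes outside the family `P` of the landed top-link assignment
`torus_topLink_assignment` (p144877): `∏_{all p} wₚ ≤ ∏_{p ∈ P} wₚ`. (2) Apply the landed triangular
integration lemma `lintegral_prod_le_pow_of_rank` (p143799) with `links p` the four links of `p`,
the assignment's `top`, `rk`, and the ONE-LINK BOUND `z = C β^{−D/2}`: since `top p` is one of the four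
(pairwise distinct, `L ≥ 2`) links of `p`, the holonomy of `update U (top p) g` is `a g b` or
`a g⁻¹ b` with `a, b` independent of `g` (`plaquetteHolonomy_update`), so by two-sided and inversion
invariance of the Haar probability measure of the compact group `G`
(`lintegral_update_plaquetteHolonomy`) the `top p`-integral of `wₚ` is the one-link Laplace integral
`∫ e^{−β (N − Re tr r(g))} dg ≤ C β^{−D/2}` (`oneLinkLaplace_le_rpow`, p141871). (3) Conclude
`Z_L(β) ≤ z ^ #P` with `#P = 3L⁴ − (L³ + L² + L)`.

Everything is proved from Mathlib and the tree (`ConstructiveQFTWave0(Proofs)` vocabulary, Haar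
invariance instances of `StrongCouplingActivities`, the trace bound `re_trace_le` of
`…TwoPointStubVarianceOfChessboardDoubling`); no named facts, no new definitions. Helpers live in the
sub-namespace `TorusUpper`.
-/

set_option autoImplicit false

noncomputable section

open MeasureTheory
open scoped ENNReal
open Literature.MathematicalPhysics.QuantumFieldTheory
open Summit.QuantumFields.YangMills.Theorems.FreeEnergyLogCoefficient (dimE)

namespace Summit.QuantumFields.YangMills.Theorems.FemtoCurvatureTwoPointC.TorusGauge

namespace TorusUpper

/-! ## Updating one link of a plaquette on the torus `(ℤ/L)⁴` -/

section Holonomy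

variable {L : ℕ} {G : Type*} [Group G]

/-- For `L ≥ 2` a unit shift moves every site of the torus: `x + e_k ≠ x`. -/
theorem shift_ne_self (hL : 2 ≤ L) (x : Site 4 L) (k : Fin 4) : x.shift k ≠ x := by
  intro h
  have h1 := congrFun h k
  rw [TopLink.shift_apply, if_pos rfl, add_eq_left] at h1
  have h2 := congrArg ZMod.val h1
  rw [TopLink.val_one_of_two_le hL, ZMod.val_zero] at h2
  exact one_ne_zero h2

/-- The plaquette holonomy `U(x,i) U(x+eᵢ,j) U(x+eⱼ,i)⁻¹ U(x,j)⁻¹` after updating one of its four links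
(`i ≠ j`, `L ≥ 2`: the four links are pairwise distinct, so the other three factors are unchanged). -/
theorem plaquetteHolonomy_update (hL : 2 ≤ L) (x : Site 4 L) {i j : Fin 4} (hij : i ≠ j)
    (U : GaugeConfig 4 L G) (g : G) :
    plaquetteHolonomy (Function.update U (x, i) g) x i j =
        g * U (x.shift i, j) * (U (x.shift j, i))⁻¹ * (U (x, j))⁻¹ ∧
    plaquetteHolonomy (Function.update U (x.shift i, j) g) x i j =
        U (x, i) * g * (U (x.shift j, i))⁻¹ * (U (x, j))⁻¹ ∧
    plaquetteHolonomy (Function.update U (x.shift j, i) g) x i j =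
        U (x, i) * U (x.shift i, j) * g⁻¹ * (U (x, j))⁻¹ ∧
    plaquetteHolonomy (Function.update U (x, j) g) x i j =
        U (x, i) * U (x.shift i, j) * (U (x.shift j, i))⁻¹ * g⁻¹ := by
  have hx : ∀ k : Fin 4, x.shift k ≠ x := shift_ne_self hL x
  have h12 : ((x, i) : Edge 4 L) ≠ (x.shift i, j) := fun h => hx i (Prod.ext_iff.1 h).1.symm
  have h13 : ((x, i) : Edge 4 L) ≠ (x.shift j, i) := fun h => hx j (Prod.ext_iff.1 h).1.symm
  have h14 : ((x, i) : Edge 4 L) ≠ (x, j) := fun h => hij (Prod.ext_iff.1 h).2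
  have h23 : ((x.shift i, j) : Edge 4 L) ≠ (x.shift j, i) :=
    fun h => hij ((Prod.ext_iff.1 h).2).symm
  have h24 : ((x.shift i, j) : Edge 4 L) ≠ (x, j) := fun h => hx i (Prod.ext_iff.1 h).1
  have h34 : ((x.shift j, i) : Edge 4 L) ≠ (x, j) := fun h => hx j (Prod.ext_iff.1 h).1
  simp only [plaquetteHolonomy, Function.update_self, Function.update_of_ne h12.symm,
    Function.update_of_ne h13.symm, Function.update_of_ne h14.symm, Function.update_of_ne h12,
    Function.update_of_ne h23.symm, Function.update_of_ne h24.symm, Function.update_of_ne h13,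
    Function.update_of_ne h23, Function.update_of_ne h34.symm, Function.update_of_ne h14,
    Function.update_of_ne h24, Function.update_of_ne h34, and_self]

/-- The plaquette holonomy depends only on the four links of the plaquette. -/
theorem plaquetteHolonomy_eq_of_eqOn (p : Plaquette 4 L) {U V : GaugeConfig 4 L G}
    (hUV : ∀ e ∈ ({(p.1, p.2.1.1), (p.1.shift p.2.1.1, p.2.1.2), (p.1.shift p.2.1.2, p.2.1.1),
      (p.1, p.2.1.2)} : Finset (Edge 4 L)), U e = V e) :
    plaquetteHolonomy U p.1 p.2.1.1 p.2.1.2 = plaquetteHolonomy V p.1 p.2.1.1 p.2.1.2 := by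
  simp only [plaquetteHolonomy]
  rw [hUV (p.1, p.2.1.1) (by simp), hUV (p.1.shift p.2.1.1, p.2.1.2) (by simp),
    hUV (p.1.shift p.2.1.2, p.2.1.1) (by simp), hUV (p.1, p.2.1.2) (by simp)]

variable [TopologicalSpace G] [IsTopologicalGroup G] [CompactSpace G] [MeasurableSpace G]
  [BorelSpace G]

/-- **Haar invariance over one link.** Integrating a measurable function of the plaquette holonomy
over ONE of the four link variables of the plaquette gives its Haar average: the holonomy of
`update U e g` is `a g b` or `a g⁻¹ b` with `a, b` independent of `g`, and the Haar probability measure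
of a compact group is two-sided invariant and inversion invariant. -/
theorem lintegral_update_plaquetteHolonomy {Φ : G → ℝ≥0∞} (hΦ : Measurable Φ) (hL : 2 ≤ L)
    (U : GaugeConfig 4 L G) (p : Plaquette 4 L) {e : Edge 4 L}
    (he : e ∈ ({(p.1, p.2.1.1), (p.1.shift p.2.1.1, p.2.1.2), (p.1.shift p.2.1.2, p.2.1.1),
      (p.1, p.2.1.2)} : Finset (Edge 4 L))) :
    ∫⁻ g, Φ (plaquetteHolonomy (Function.update U e g) p.1 p.2.1.1 p.2.1.2) ∂haarProbability G =
      ∫⁻ g, Φ g ∂haarProbability G := by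
  obtain ⟨x, ⟨⟨i, j⟩, hij⟩⟩ := p
  have hne : i ≠ j := ne_of_lt hij
  -- two-sided (`g ↦ a g b`) and twisted (`g ↦ a g⁻¹ b`) invariance of the Haar probability measure
  have hconj : ∀ a b : G, ∫⁻ g, Φ (a * g * b) ∂haarProbability G = ∫⁻ g, Φ g ∂haarProbability G :=
    fun a b => (WilsonGauge.measurePreserving_mul_mul a b).lintegral_comp hΦ
  have hconj_inv : ∀ a b : G,
      ∫⁻ g, Φ (a * g⁻¹ * b) ∂haarProbability G = ∫⁻ g, Φ g ∂haarProbability G :=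
    fun a b => ((WilsonGauge.measurePreserving_mul_mul a b).comp
      (Measure.measurePreserving_inv (haarProbability G))).lintegral_comp hΦ
  simp only [Finset.mem_insert, Finset.mem_singleton] at he
  rcases he with rfl | rfl | rfl | rfl
  · have hupd : ∀ g, plaquetteHolonomy (Function.update U (x, i) g) x i j =
        1 * g * (U (x.shift i, j) * (U (x.shift j, i))⁻¹ * (U (x, j))⁻¹) := fun g => by
      rw [(plaquetteHolonomy_update hL x hne U g).1]; group
    simp_rw [hupd]
    exact hconj _ _
  · have hupd : ∀ g, plaquetteHolonomy (Function.update U (x.shift i, j) g) x i j =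
        U (x, i) * g * ((U (x.shift j, i))⁻¹ * (U (x, j))⁻¹) := fun g => by
      rw [(plaquetteHolonomy_update hL x hne U g).2.1]; group
    simp_rw [hupd]
    exact hconj _ _
  · have hupd : ∀ g, plaquetteHolonomy (Function.update U (x.shift j, i) g) x i j =
        U (x, i) * U (x.shift i, j) * g⁻¹ * (U (x, j))⁻¹ := fun g =>
      (plaquetteHolonomy_update hL x hne U g).2.2.1
    simp_rw [hupd]
    exact hconj_inv _ _
  · have hupd : ∀ g, plaquetteHolonomy (Function.update U (x, j) g) x i j =
        U (x, i) * U (x.shift i, j) * (U (x.shift j, i))⁻¹ * g⁻¹ * 1 := fun g => by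
      rw [(plaquetteHolonomy_update hL x hne U g).2.2.2, mul_one]
    simp_rw [hupd]
    exact hconj_inv _ _

end Holonomy

/-! ## The one-link Boltzmann factor and the plaquette weights -/

section Weight

variable {N : ℕ} {G : Type*} [Group G] [TopologicalSpace G] [IsTopologicalGroup G] [CompactSpace G]
  (ρ : G →* Matrix (Fin N) (Fin N) ℂ)

omit [IsTopologicalGroup G] [CompactSpace G] in
/-- The one-link Boltzmann factor `g ↦ e^{−β (N − Re tr ρ(g))}` is continuous. -/
theorem continuous_boltzmann (hρ : Continuous ρ) (β : ℝ) :
    Continuous fun g : G => Real.exp (-(β * ((N : ℝ) - (ρ g).trace.re))) :=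
  Real.continuous_exp.comp (continuous_const.mul (continuous_const.sub
    (continuous_trace_re ρ hρ))).neg

/-- For `β ≥ 0` the Boltzmann factor is at most `1` (the plaquette energy `N − Re tr ρ` is `≥ 0`,
`FemtoCurvatureTwoPoint.PlaquetteVariance.re_trace_le`). -/
theorem ofReal_boltzmann_le_one (hρ : Continuous ρ) {β : ℝ} (hβ : 0 ≤ β) (g : G) :
    ENNReal.ofReal (Real.exp (-(β * ((N : ℝ) - (ρ g).trace.re)))) ≤ 1 :=
  ENNReal.ofReal_le_one.2 (Real.exp_le_one_iff.2 (neg_nonpos.2 (mul_nonneg hβ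
    (sub_nonneg.2 (FemtoCurvatureTwoPoint.PlaquetteVariance.re_trace_le ρ hρ g)))))

variable [MeasurableSpace G] [BorelSpace G]

omit [IsTopologicalGroup G] [CompactSpace G] in
/-- The one-link Boltzmann factor, as an extended non-negative real, is measurable. -/
theorem measurable_ofReal_boltzmann (hρ : Continuous ρ) (β : ℝ) :
    Measurable fun g : G => ENNReal.ofReal (Real.exp (-(β * ((N : ℝ) - (ρ g).trace.re)))) :=
  ENNReal.measurable_ofReal.comp (continuous_boltzmann ρ hρ β).measurable

/-- The lower Lebesgue integral of the Boltzmann factor is the one-link Laplace integral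
`∫ e^{−β (N − Re tr ρ(g))} dg`. -/
theorem lintegral_ofReal_boltzmann (hρ : Continuous ρ) (β : ℝ) :
    ∫⁻ g, ENNReal.ofReal (Real.exp (-(β * ((N : ℝ) - (ρ g).trace.re)))) ∂haarProbability G =
      ENNReal.ofReal (∫ g, Real.exp (-(β * ((N : ℝ) - (ρ g).trace.re))) ∂haarProbability G) := by
  refine (ofReal_integral_eq_lintegral_ofReal ?_ (ae_of_all _ fun g => (Real.exp_pos _).le)).symm
  exact (continuous_boltzmann ρ hρ β).integrable_of_hasCompactSupport
    (HasCompactSupport.of_compactSpace _)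

omit [CompactSpace G] in
/-- The plaquette weight `U ↦ e^{−β (N − Re tr ρ(U_p))}` is measurable for the product σ-algebra
(no countability assumption on `G`: `WilsonRP.measurable_plaqRe`). -/
theorem measurable_weight {d L : ℕ} (hρ : Continuous ρ) (β : ℝ) (p : Plaquette d L) :
    Measurable fun U : GaugeConfig d L G => ENNReal.ofReal
      (Real.exp (-(β * ((N : ℝ) - (ρ (plaquetteHolonomy U p.1 p.2.1.1 p.2.1.2)).trace.re)))) :=
  ENNReal.measurable_ofReal.comp (Real.measurable_exp.comp
    ((measurable_const.sub (WilsonRP.measurable_plaqRe ρ hρ p)).const_mul β).neg)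

/-- **The partition function as the integral of the product of the plaquette weights**:
`Z_L(β) = ∫ ∏ₚ e^{−β (N − Re tr ρ(U_p))} dHaar^{⊗E}` (in `ℝ≥0∞`; `e^{−β S}` with `S = Σₚ (N − Re tr ρ(U_p))`
is the product of the plaquette factors). -/
theorem partitionFunction_eq_lintegral_prod {d L : ℕ} [NeZero L] (β : ℝ) :
    partitionFunction (d := d) (L := L) ρ β =
      ∫⁻ U, ∏ p : Plaquette d L, ENNReal.ofReal
        (Real.exp (-(β * ((N : ℝ) - (ρ (plaquetteHolonomy U p.1 p.2.1.1 p.2.1.2)).trace.re))))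
        ∂(Measure.pi fun _ : Edge d L => haarProbability G) := by
  simp only [partitionFunction, wilsonWeight, withDensity_apply _ MeasurableSet.univ,
    Measure.restrict_univ]
  refine lintegral_congr fun U => ?_
  rw [← ENNReal.ofReal_prod_of_nonneg fun p _ => (Real.exp_pos _).le, ← Real.exp_sum]
  congr 1
  rw [wilsonAction, neg_mul, Finset.mul_sum, ← Finset.sum_neg_distrib]

end Weight

end TorusUpper

/-! ## The registered statement -/

/-- **Triangular upper bound for the torus partition function** (registered wave-4 sub-goal of line
`birth`, crux `FemtoCurvatureTwoPointC`, stmt-QuantumFields-16204; the signature verbatim): for a compact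
second-countable group `G` with a faithful continuous unitary lattice representation `r`, `D = dimE r.ρ`,
there is `C > 0` (the one-link Laplace constant of `oneLinkLaplace_le_rpow`) with
`Z_L(β) ≤ (C β^{−D/2}) ^ (3L⁴ − L³ − L² − L)` for all `L ≥ 2`, `β ≥ 1`. Write `Z_L(β) = ∫ ∏ₚ wₚ` with
`wₚ = e^{−β(N − Re tr r(U_p))} ≤ 1`, keep only the `3L⁴ − L³ − L² − L` plaquettes of the top-link family
(`torus_topLink_assignment`), and integrate the links out from the highest rank down
(`lintegral_prod_le_pow_of_rank`): each member contributes one factor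
`∫ wₚ dU_{top p} = ∫ e^{−β(N − Re tr r(g))} dg ≤ C β^{−D/2}` by Haar invariance over one link
(`TorusUpper.lintegral_update_plaquetteHolonomy`). -/
theorem torusPartitionFunction_upper :
    ∀ {G : Type} [Group G] [TopologicalSpace G] [IsTopologicalGroup G] [CompactSpace G]
      [MeasurableSpace G] [BorelSpace G] [SecondCountableTopology G] (r : LatticeRep G),
      ∃ C : ℝ, 0 < C ∧ ∀ (L : ℕ) [NeZero L] (β : ℝ), 2 ≤ L → 1 ≤ β →
        (partitionFunction (d := 4) (L := L) r.ρ β).toReal ≤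
          (C * β ^ (-((dimE r.ρ : ℝ) / 2))) ^ (3 * L ^ 4 - (L ^ 3 + L ^ 2 + L)) := by
  intro G _ _ _ _ _ _ _ r
  obtain ⟨C, hC, hlap⟩ :=
    FemtoCurvatureTwoPointC.oneLinkLaplace_le_rpow r.ρ r.continuous r.injective r.mem_unitary
  refine ⟨C, hC, fun L _ β hL hβ => ?_⟩
  obtain ⟨P, top, rk, hrk, htop, hcard, hP⟩ := torus_topLink_assignment L hL
  have hβ0 : 0 ≤ β := zero_le_one.trans hβ
  have hz0 : 0 ≤ C * β ^ (-((dimE r.ρ : ℝ) / 2)) :=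
    (mul_pos hC (Real.rpow_pos_of_pos (zero_lt_one.trans_le hβ) _)).le
  -- the four links of a plaquette and the plaquette weights
  let links : Plaquette 4 L → Finset (Edge 4 L) := fun p =>
    {(p.1, p.2.1.1), (p.1.shift p.2.1.1, p.2.1.2), (p.1.shift p.2.1.2, p.2.1.1), (p.1, p.2.1.2)}
  let w : Plaquette 4 L → GaugeConfig 4 L G → ℝ≥0∞ := fun p U => ENNReal.ofReal
    (Real.exp (-(β * ((r.N : ℝ) - (r.ρ (plaquetteHolonomy U p.1 p.2.1.1 p.2.1.2)).trace.re))))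
  have hw1 : ∀ (p : Plaquette 4 L) (U : GaugeConfig 4 L G), w p U ≤ 1 := fun p U =>
    TorusUpper.ofReal_boltzmann_le_one r.ρ r.continuous hβ0 _
  -- (1) drop the plaquettes outside the family `P`
  have hdrop : ∀ U : GaugeConfig 4 L G, ∏ p, w p U ≤ ∏ p ∈ P, w p U := fun U =>
    Finset.prod_le_prod_of_subset_of_le_one' (Finset.subset_univ P) fun p _ _ => hw1 p U
  -- (2) triangular integration over the family `P`, one link bound `z = C β^{-D/2}`
  have hmain : ∫⁻ U, ∏ p ∈ P, w p U ∂(Measure.pi fun _ : Edge 4 L => haarProbability G) ≤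
      ENNReal.ofReal (C * β ^ (-((dimE r.ρ : ℝ) / 2))) ^ P.card := by
    refine lintegral_prod_le_pow_of_rank (haarProbability G) P links top rk hrk htop
      (fun p hp => (hP p hp).1) (fun p hp => (hP p hp).2) w
      (fun p _ => TorusUpper.measurable_weight r.ρ r.continuous β p) (fun p _ U => hw1 p U)
      (fun p _ U V hUV => ?_) _ (fun p hp U => ?_)
    · -- the weight of `p` depends only on the four links of `p`
      show ENNReal.ofReal _ = ENNReal.ofReal _
      rw [TorusUpper.plaquetteHolonomy_eq_of_eqOn p fun e he => hUV e (Finset.mem_coe.2 he)]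
    · -- integrating out the top link of `p` gives the one-link Laplace integral
      show ∫⁻ g, ENNReal.ofReal (Real.exp (-(β * ((r.N : ℝ) -
          (r.ρ (plaquetteHolonomy (Function.update U (top p) g) p.1 p.2.1.1 p.2.1.2)).trace.re))))
          ∂haarProbability G ≤ _
      rw [TorusUpper.lintegral_update_plaquetteHolonomy
          (TorusUpper.measurable_ofReal_boltzmann r.ρ r.continuous β) hL U p (hP p hp).1,
        TorusUpper.lintegral_ofReal_boltzmann r.ρ r.continuous β]
      exact ENNReal.ofReal_le_ofReal (hlap β hβ)
  -- (3) assemble: `Z ≤ z ^ #P`, `#P = 3L⁴ − (L³ + L² + L)`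
  have hcardP : P.card = 3 * L ^ 4 - (L ^ 3 + L ^ 2 + L) := by omega
  have hZ : partitionFunction (d := 4) (L := L) r.ρ β ≤
      ENNReal.ofReal (C * β ^ (-((dimE r.ρ : ℝ) / 2))) ^ P.card := by
    rw [TorusUpper.partitionFunction_eq_lintegral_prod r.ρ β]
    exact (lintegral_mono fun U => hdrop U).trans hmain
  calc (partitionFunction (d := 4) (L := L) r.ρ β).toReal
      ≤ (ENNReal.ofReal (C * β ^ (-((dimE r.ρ : ℝ) / 2))) ^ P.card).toReal :=
        ENNReal.toReal_mono (ENNReal.pow_ne_top ENNReal.ofReal_ne_top) hZ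
    _ = (C * β ^ (-((dimE r.ρ : ℝ) / 2))) ^ (3 * L ^ 4 - (L ^ 3 + L ^ 2 + L)) := by
        rw [ENNReal.toReal_pow, ENNReal.toReal_ofReal hz0, hcardP]

end Summit.QuantumFields.YangMills.Theorems.FemtoCurvatureTwoPointC.TorusGauge

end
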